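import Literature.Topology.FourManifolds.HomotopySpheresSum
import Literature.Topology.FourManifolds.HomotopySpheresInverse
import Literature.Topology.FourManifolds.PuncturedHomotopySphere
import Literature.Topology.FourManifolds.PuncturedHomotopySphereHomology
import Literature.Topology.FourManifolds.PalaisBallComplement
import Literature.Topology.FourManifolds.ClosedBallProofs
import Literature.Topology.FourManifolds.CollarExtension
import Literature.AlgebraicTopology.Homotopy.WhiteheadContractible
import HarnessLib

/-!
# Sums of homotopy spheres: the contractibility of punctured homotopy spheres, reduced to Whitehead–Hurewicz and the low-dimensional Poincaré conjecture

Topic `Literature/Topology/FourManifolds`, sibling proofs file of `HomotopySpheresSum.lean`. That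
file reduced Kervaire–Milnor's "the sum of two homotopy `n`-spheres is a homotopy `n`-sphere"
(*Groups of homotopy spheres I* (1963), §2, p. 505; tree fact
`Literature.Topology.FourManifolds.HomotopySphere.nonempty_homotopyEquiv_sphere_of_isConnectedSum`) to the named fact
`Literature.Topology.FourManifolds.HomotopySphere.contractibleSpace_compl_image_ball` — a homotopy sphere with the interior of
a disc deleted is contractible (Kosinski, *Differential Manifolds* (1993), VI §1). Here that fact
is proved in every dimension in which its classical proof is available in the tree, and reduced
to two deep inputs otherwise:

* `n = 0` (**proved**, `contractibleSpace_compl_image_ball_zero`): a homotopy `0`-sphere has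
  exactly two points (a `0`-manifold is discrete — tree lemma
  `Literature.Topology.FourManifolds.discreteTopology_of_chartedSpace_fin_zero`, `CollarExtension.lean` — and homotopic maps
  into a discrete space are equal), so the complement of a disc is one point.
* `Σ` diffeomorphic to `Sⁿ` (**proved**, `contractibleSpace_compl_image_ball_of_diffeomorph`):
  by Palais' disc theorem in ball-complement form (tree theorem
  `Literature.Topology.FourManifolds.hasComplementBall_of_isSmoothEmbedding`, `PalaisBallComplement.lean`; Palais 1960, Thm. B,
  Hirsch 1976, Ch. 8 Thm. 3.1) the complement of a smooth open disc in `Sⁿ` is a smooth closed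
  disc, which is convex, hence contractible. With the smooth Poincaré conjecture in dimensions
  `1` and `2` (classification of curves and surfaces; hypothesis `h12`, an instance of the tree
  fact `Literature.Topology.FourManifolds.nonemptyDiffeomorphSphere_of_mem`, spc4.S32) this settles `n = 1, 2`
  (`contractibleSpace_compl_image_ball_of_nonemptyDiffeomorphSphere`).
* `n ≥ 3` (**proved from the Whitehead–Hurewicz recognition principle**,
  `contractibleSpace_compl_image_ball_of_whitehead`): `Σ ∖ i(B)` is a deformation retract of
  `Σ ∖ {i 0}` (`BallComplementRetract.lean`), which is a simply connected
  (`PuncturedHomotopySphere.lean`, general position, `n ≥ 3`) open `n`-manifold with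
  `Hₖ(Σ ∖ {i 0}; ℤ) = 0` for all `k ≥ 1` (`PuncturedHomotopySphereHomology.lean`, Mayer–Vietoris,
  Hatcher Prop. 3.29 and the Bockstein), hence contractible by the named fact
  `Literature.AlgebraicTopology.Homotopy.Manifold.contractibleSpace_of_simplyConnected_of_acyclic` (Bredon 1993, VII Cor. 10.11,
  + Milnor 1959, Cor. 1) — exactly the argument "simply connected and acyclic, hence
  contractible" of Kosinski 1993, VI §2, Prop. 2.1.

The same dichotomy proves the punctured form `Literature.Topology.FourManifolds.HomotopySphere.contractibleSpace_compl_singleton`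
(named fact of `HomotopySpheresInverse.lean`, the homotopy theory in Kervaire–Milnor's Lemma 2.4,
`n ≥ 2`): `Sⁿ ∖ {v} ≅ ℝⁿ` by stereographic projection for `Σ ≅ Sⁿ`, Whitehead–Hurewicz for
`n ≥ 3` (`contractibleSpace_compl_singleton_of`, `…_of_facts`).

Assembled: `Literature.Topology.FourManifolds.HomotopySphere.contractibleSpace_compl_image_ball_of` (the named fact of
`HomotopySpheresSum.lean` from the Whitehead–Hurewicz fact and smooth Poincaré in dimensions
`1, 2`), `…_of_facts` (the same with the tree fact spc4.S32 as the low-dimensional input), and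
**`Literature.Topology.FourManifolds.HomotopySphere.nonempty_homotopyEquiv_sphere_of_isConnectedSum_of_facts`**:
Kervaire–Milnor's statement for all `n` from these two named facts, everything else proved.

## References

* M. Kervaire, J. Milnor, *Groups of homotopy spheres I*, Ann. of Math. 77 (1963), §2 p. 505,
  proof of Lemma 2.4 p. 507. [KervaireMilnorAnnals1963]
* A. Kosinski, *Differential Manifolds*, Academic Press (1993), Ch. VI §1 (remark before
  Cor. 1.4), §2 Prop. 2.1. [Kosinski1993]
* R. Palais, *Extending diffeomorphisms*, Proc. AMS 11 (1960), Thm. B. [Palais1960]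
* M. W. Hirsch, *Differential Topology*, GTM 33 (1976), Ch. 8 Thm. 3.1. [HirschDT1976]
* G. E. Bredon, *Topology and Geometry*, GTM 139 (1993), Ch. VII Cor. 10.11. [Bredon1993]
* J. Milnor, *On spaces having the homotopy type of a CW-complex*, Trans. AMS 90 (1959),
  Cor. 1. [Milnor1959]
-/

open scoped Manifold ContDiff Topology ContinuousMap unitInterval
open CategoryTheory Limits Set Function Metric Module Topology

noncomputable section

namespace Literature.Topology.FourManifolds

/-- Local notation: `𝔼 n` is the model Euclidean space `EuclideanSpace ℝ (Fin n)`. -/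
local notation "𝔼 " n:arg => EuclideanSpace ℝ (Fin n)

/-- Local notation: `𝕊 n` is the unit sphere in `EuclideanSpace ℝ (Fin (n + 1))`, the standard
`n`-sphere with its Mathlib analytic manifold structure. -/
local notation "𝕊 " n:arg => (Metric.sphere (0 : EuclideanSpace ℝ (Fin (n + 1))) 1)

attribute [local instance] fact_finrank_euclideanSpace_succ

/-! ### Discrete spaces and dimension `0` -/

section Discrete

/-- Homotopic maps into a discrete space are equal (each track `t ↦ H (t, x)` is a continuous
map from the connected unit interval to a discrete space). [folklore] -/
theorem eq_of_homotopic_of_discreteTopology {X Y : Type*} [TopologicalSpace X]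
    [TopologicalSpace Y] [DiscreteTopology Y] {f g : C(X, Y)} (h : f.Homotopic g) : f = g := by
  obtain ⟨H⟩ := h
  ext x
  have hI : PreconnectedSpace I := Subtype.preconnectedSpace isPreconnected_Icc
  have hc := hI.constant (f := fun t : I => H (t, x)) (by fun_prop) (x := 0) (y := 1)
  simpa using hc

/-- A homotopy equivalence between discrete spaces is a bijection (its homotopy inverse is an
inverse). [folklore] -/
def equivOfHomotopyEquivOfDiscrete {X Y : Type*} [TopologicalSpace X]
    [TopologicalSpace Y] [DiscreteTopology X] [DiscreteTopology Y] (e : X ≃ₕ Y) : X ≃ Y where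
  toFun := e.toFun
  invFun := e.invFun
  left_inv x := by
    have h := eq_of_homotopic_of_discreteTopology e.left_inv
    exact congrArg (fun φ : C(X, X) => φ x) h
  right_inv y := by
    have h := eq_of_homotopic_of_discreteTopology e.right_inv
    exact congrArg (fun φ : C(Y, Y) => φ y) h

/-- The points of `S⁰ ⊆ ℝ¹`: a unit vector of `ℝ¹` other than `v` is `-v`. [folklore] -/
theorem sphere_zero_eq_neg_of_ne {v w : 𝕊 0} (h : w ≠ v) : w = -v := by
  have hv : |(v : 𝔼 1) 0| = 1 := by
    have := norm_eq_of_mem_sphere v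
    rw [EuclideanSpace.norm_eq, Fin.sum_univ_one, Real.norm_eq_abs, sq_abs,
      Real.sqrt_sq_eq_abs] at this
    exact this
  have hw : |(w : 𝔼 1) 0| = 1 := by
    have := norm_eq_of_mem_sphere w
    rw [EuclideanSpace.norm_eq, Fin.sum_univ_one, Real.norm_eq_abs, sq_abs,
      Real.sqrt_sq_eq_abs] at this
    exact this
  have key : (w : 𝔼 1) 0 = -(v : 𝔼 1) 0 := by
    rcases abs_eq_abs.mp (hw.trans hv.symm) with h1 | h1
    · exfalso
      apply h
      refine Subtype.ext (PiLp.ext fun j => ?_)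
      rw [Fin.fin_one_eq_zero j]
      exact h1
    · exact h1
  refine Subtype.ext (PiLp.ext fun j => ?_)
  rw [Fin.fin_one_eq_zero j, key]
  rfl

/-- In `S⁰`, `-v ≠ v`. [folklore] -/
theorem sphere_zero_neg_ne (v : 𝕊 0) : -v ≠ v := fun h => by
  have h0 : (v : 𝔼 1) = 0 := by
    have h' : -(v : 𝔼 1) = v := congrArg Subtype.val h
    have h2 : (2 : ℝ) • (v : 𝔼 1) = 0 := by
      rw [two_smul]
      nth_rw 1 [← h']
      exact neg_add_cancel _
    exact (smul_eq_zero.mp h2).resolve_left two_ne_zero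
  have := norm_eq_of_mem_sphere v
  rw [h0, norm_zero] at this
  exact zero_ne_one this

end Discrete

namespace HomotopySphere

/-! ### Dimension `0`: a homotopy `0`-sphere has two points -/

/-- **Punctured homotopy `0`-spheres are points**: for a homotopy `0`-sphere `Σ` and `p ∈ Σ`
the complement `Σ ∖ {p}` has exactly one point. (`Σ` and `S⁰` are discrete, so the homotopy
equivalence `Σ ≃ₕ S⁰` is a bijection, and `S⁰ = {v, -v}`.) [folklore] -/
theorem nonempty_unique_compl_singleton_zero (S : HomotopySphere 0) (p : S.carrier) :
    Nonempty (Unique ↥(({p}ᶜ : Set S.carrier))) := by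
  haveI : DiscreteTopology S.carrier := discreteTopology_of_chartedSpace_fin_zero S.carrier
  haveI : DiscreteTopology (𝕊 0) := discreteTopology_of_chartedSpace_fin_zero (𝕊 0)
  obtain ⟨e⟩ := S.nonempty_homotopyEquiv
  let f : S.carrier ≃ 𝕊 0 := equivOfHomotopyEquivOfDiscrete e
  refine ⟨⟨⟨⟨f.symm (-f p), fun h => sphere_zero_neg_ne (f p) ?_⟩⟩, fun y => Subtype.ext ?_⟩⟩
  · have := congrArg f (mem_singleton_iff.mp (not_notMem.mp (fun h' => h' h)))
    simpa using this
  · have hy : f (y : S.carrier) ≠ f p := fun h => y.2 (f.injective h)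
    change (y : S.carrier) = f.symm (-f p)
    rw [Equiv.eq_symm_apply]
    exact sphere_zero_eq_neg_of_ne hy

/-- **`contractibleSpace_compl_image_ball` in dimension `0`** (proved): the disc `i : ℝ⁰ → Σ` is
a point `i 0`, and `Σ ∖ {i 0}` is a single point, hence contractible. [folklore] -/
theorem contractibleSpace_compl_image_ball_zero (S : HomotopySphere 0) (i : 𝔼 0 → S.carrier) :
    ContractibleSpace ↥((i '' ball (0 : 𝔼 0) 1)ᶜ) := by
  have hset : i '' ball (0 : 𝔼 0) 1 = {i 0} := by
    ext y
    simp only [mem_image, mem_ball, dist_zero_right, mem_singleton_iff]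
    constructor
    · rintro ⟨v, -, rfl⟩
      rw [Subsingleton.elim v 0]
    · rintro rfl
      exact ⟨0, by simp, rfl⟩
  rw [hset]
  obtain ⟨hU⟩ := S.nonempty_unique_compl_singleton_zero (i 0)
  exact ⟨⟨(Homeomorph.homeomorphOfUnique ↥(({i 0}ᶜ : Set S.carrier)) Unit).toHomotopyEquiv⟩⟩

/-! ### The standard sphere: Palais' disc theorem -/

/-- **The complement of a smooth open disc in the sphere is contractible**: for a smooth
embedding `e : ℝⁿ → Sⁿ` (the unit sphere of an `(n+1)`-dimensional inner product space),
`Sⁿ ∖ e(B)` is the image of the closed unit disc under a complementary smooth disc (Palais' disc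
theorem in ball-complement form, tree theorem `Literature.Topology.FourManifolds.hasComplementBall_of_isSmoothEmbedding`;
Palais 1960, Thm. B; Hirsch 1976, Ch. 8 Thm. 3.1), and the closed disc is convex, hence
contractible. [cite: HirschDT1976, Ch. 8 Thm. 3.1] [cite: Palais1960, Thm. B] -/
theorem contractibleSpace_compl_image_ball_unitSphere {V : Type*} [NormedAddCommGroup V]
    [InnerProductSpace ℝ V] {n : ℕ} [Fact (finrank ℝ V = n + 1)]
    {e : 𝔼 n → Metric.sphere (0 : V) 1} (he : Manifold.IsSmoothEmbedding (𝓡 n) (𝓡 n) ∞ e) :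
    ContractibleSpace ↥((e '' ball (0 : 𝔼 n) 1)ᶜ) := by
  obtain ⟨U, c, -, hc⟩ := hasComplementBall_of_isSmoothEmbedding he
  -- the complementary closed disc `g : 𝔻ⁿ → Sⁿ`, a closed embedding of a compact convex set
  let g : ↥(closedBall (0 : 𝔼 n) 1) → Metric.sphere (0 : V) 1 := fun y => (c y : Metric.sphere (0 : V) 1)
  have hg : Continuous g :=
    continuous_subtype_val.comp (c.continuous.comp continuous_subtype_val)
  have hginj : Injective g := fun y y' h =>
    Subtype.ext (c.injective (Subtype.ext h))
  haveI : CompactSpace ↥(closedBall (0 : 𝔼 n) 1) :=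
    isCompact_iff_compactSpace.mp (isCompact_closedBall _ _)
  have hemb : IsClosedEmbedding g := hg.isClosedEmbedding hginj
  have hrange : range g = (e '' ball (0 : 𝔼 n) 1)ᶜ := by
    rw [← hc]
    ext z
    simp only [mem_range, mem_image, Subtype.exists, comp_apply, g]
    constructor
    · rintro ⟨y, hy, rfl⟩
      exact ⟨y, hy, rfl⟩
    · rintro ⟨y, hy, rfl⟩
      exact ⟨y, hy, rfl⟩
  haveI : ContractibleSpace ↥(closedBall (0 : 𝔼 n) 1) :=
    (convex_closedBall (0 : 𝔼 n) 1).contractibleSpace ⟨0, mem_closedBall_self zero_le_one⟩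
  have eH : ↥(closedBall (0 : 𝔼 n) 1) ≃ₜ ↥((e '' ball (0 : 𝔼 n) 1)ᶜ) :=
    hemb.isEmbedding.toHomeomorph.trans (Homeomorph.setCongr hrange)
  exact eH.symm.contractibleSpace

/-- **A punctured sphere is contractible**: `Sⁿ ∖ {v} ≅ ℝⁿ` by the stereographic projection
from `v` (Mathlib's `stereographic'`), and `ℝⁿ` is contractible. [folklore] -/
theorem contractibleSpace_compl_singleton_unitSphere {V : Type*} [NormedAddCommGroup V]
    [InnerProductSpace ℝ V] {n : ℕ} [Fact (finrank ℝ V = n + 1)] (v : Metric.sphere (0 : V) 1) :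
    ContractibleSpace ↥(({v}ᶜ : Set (Metric.sphere (0 : V) 1))) := by
  let e := stereographic' n v
  have h1 : ↥(({v}ᶜ : Set (Metric.sphere (0 : V) 1))) ≃ₜ ↥(e.target) :=
    (Homeomorph.setCongr (stereographic'_source v).symm).trans e.toHomeomorphSourceTarget
  have h2 : ↥(e.target) ≃ₜ 𝔼 n :=
    (Homeomorph.setCongr (stereographic'_target v)).trans (Homeomorph.Set.univ _)
  exact (h1.trans h2).contractibleSpace

/-- **Punctured homotopy spheres diffeomorphic to `Sⁿ` are contractible** (proved): transport
along `φ : Σ ≅ Sⁿ` and use the stereographic projection. [folklore] -/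
theorem contractibleSpace_compl_singleton_of_diffeomorph {n : ℕ} (S : HomotopySphere n)
    (φ : S.carrier ≃ₘ⟮𝓡 n, 𝓡 n⟯ 𝕊 n) (p : S.carrier) :
    ContractibleSpace ↥(({p}ᶜ : Set S.carrier)) := by
  haveI := contractibleSpace_compl_singleton_unitSphere (n := n) (φ p)
  have eH : ↥(({p}ᶜ : Set S.carrier)) ≃ₜ ↥(({φ p}ᶜ : Set (𝕊 n))) :=
    φ.toHomeomorph.subtype fun x => by
      simp only [mem_compl_iff, mem_singleton_iff, Diffeomorph.coe_toHomeomorph]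
      exact (not_congr φ.injective.eq_iff).symm
  exact eH.contractibleSpace

/-- **Punctured homotopy spheres are contractible in a dimension where the smooth Poincaré
conjecture holds** (proved from that hypothesis; `n = 1, 2` by the tree fact spc4.S32). [folklore] -/
theorem contractibleSpace_compl_singleton_of_nonemptyDiffeomorphSphere {n : ℕ}
    (h : ∀ (M : Type) [TopologicalSpace M] [T2Space M] [SecondCountableTopology M],
      ContinuousMap.HomotopyEquiv.NonemptyDiffeomorphSphere M n)
    (S : HomotopySphere n) (p : S.carrier) : ContractibleSpace ↥(({p}ᶜ : Set S.carrier)) := by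
  obtain ⟨e⟩ := S.nonempty_homotopyEquiv
  obtain ⟨φ⟩ := h S.carrier S.chartedSpace S.isManifold e
  exact S.contractibleSpace_compl_singleton_of_diffeomorph φ p

/-- **`contractibleSpace_compl_image_ball` for homotopy spheres diffeomorphic to `Sⁿ`**
(proved): transport the disc along the diffeomorphism `φ : Σ ≅ Sⁿ` and apply Palais' theorem on
the sphere (`contractibleSpace_compl_image_ball_unitSphere`). [cite: HirschDT1976, Ch. 8 Thm. 3.1] -/
theorem contractibleSpace_compl_image_ball_of_diffeomorph {n : ℕ} (S : HomotopySphere n)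
    (φ : S.carrier ≃ₘ⟮𝓡 n, 𝓡 n⟯ 𝕊 n) {i : 𝔼 n → S.carrier}
    (hi : Manifold.IsSmoothEmbedding 𝓘(ℝ, 𝔼 n) (𝓡 n) ∞ i) :
    ContractibleSpace ↥((i '' ball (0 : 𝔼 n) 1)ᶜ) := by
  have he : Manifold.IsSmoothEmbedding (𝓡 n) (𝓡 n) ∞ (φ ∘ i) := hi.diffeomorph_comp φ
  haveI := contractibleSpace_compl_image_ball_unitSphere he
  -- `φ` restricts to `Σ ∖ i(B) ≃ₜ Sⁿ ∖ φ(i(B))`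
  have eH : ↥((i '' ball (0 : 𝔼 n) 1)ᶜ) ≃ₜ ↥(((φ ∘ i) '' ball (0 : 𝔼 n) 1)ᶜ) :=
    φ.toHomeomorph.subtype fun x => by
      simp only [mem_compl_iff, mem_image, comp_apply, not_exists, not_and]
      refine forall_congr' fun v => imp_congr_right fun _ => ?_
      rw [not_congr]
      exact φ.toHomeomorph.injective.eq_iff.symm
  exact eH.contractibleSpace

/-- **`contractibleSpace_compl_image_ball` for the standard spheres** (proved, all `n`, all
orientations): the unconditional instance `Σ = Sⁿ` of the named fact (non-vacuity of its
hypotheses and truth of its conclusion in the model case), by Palais' theorem.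
[cite: HirschDT1976, Ch. 8 Thm. 3.1] -/
theorem contractibleSpace_compl_image_ball_sphere {n : ℕ} (o : SmoothOrientation (𝓡 n) (𝕊 n))
    {i : 𝔼 n → (HomotopySphere.sphere o).carrier}
    (hi : Manifold.IsSmoothEmbedding 𝓘(ℝ, 𝔼 n) (𝓡 n) ∞ i) :
    ContractibleSpace ↥((i '' ball (0 : 𝔼 n) 1)ᶜ) :=
  (HomotopySphere.sphere o).contractibleSpace_compl_image_ball_of_diffeomorph (Diffeomorph.refl _ _ _) hi

/-- **`contractibleSpace_compl_image_ball` in a dimension where the smooth Poincaré conjecture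
holds** (proved from that hypothesis): if every closed smooth `n`-manifold homotopy equivalent
to `Sⁿ` is diffeomorphic to `Sⁿ` (Mathlib's `ContinuousMap.HomotopyEquiv.NonemptyDiffeomorphSphere`,
true for `n = 1, 2` by the classification of curves and surfaces — tree fact
`Literature.Topology.FourManifolds.nonemptyDiffeomorphSphere_of_mem`, spc4.S32), then punctured homotopy `n`-spheres are
contractible. [cite: Kosinski1993, Ch. VI §1 (remark before Cor. 1.4)] -/
theorem contractibleSpace_compl_image_ball_of_nonemptyDiffeomorphSphere {n : ℕ}
    (h : ∀ (M : Type) [TopologicalSpace M] [T2Space M] [SecondCountableTopology M],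
      ContinuousMap.HomotopyEquiv.NonemptyDiffeomorphSphere M n)
    (S : HomotopySphere n) {i : 𝔼 n → S.carrier}
    (hi : Manifold.IsSmoothEmbedding 𝓘(ℝ, 𝔼 n) (𝓡 n) ∞ i) :
    ContractibleSpace ↥((i '' ball (0 : 𝔼 n) 1)ᶜ) := by
  obtain ⟨e⟩ := S.nonempty_homotopyEquiv
  obtain ⟨φ⟩ := h S.carrier S.chartedSpace S.isManifold e
  exact S.contractibleSpace_compl_image_ball_of_diffeomorph φ hi

/-! ### Dimension `≥ 3`: Whitehead–Hurewicz -/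

/-- **Punctured homotopy spheres are contractible in dimensions `n ≥ 3`, from the
Whitehead–Hurewicz recognition principle**: `Σ ∖ {p}` is a simply connected (`n ≥ 3`,
`PuncturedHomotopySphere.lean`) open `n`-manifold with vanishing integral homology in positive
degrees (`PuncturedHomotopySphereHomology.lean`), hence contractible by the named fact
`Literature.AlgebraicTopology.Homotopy.Manifold.contractibleSpace_of_simplyConnected_of_acyclic` (Bredon 1993, VII Cor. 10.11, with
Milnor 1959, Cor. 1). This is Kosinski's argument (*Differential Manifolds* (1993), VI §2,
Prop. 2.1) and the homotopy theory in Kervaire–Milnor's Lemma 2.4 (p. 507).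
[cite: Kosinski1993, Ch. VI §2 Prop. 2.1] [cite: Bredon1993, Ch. VII Cor. 10.11] -/
theorem contractibleSpace_compl_singleton_of_whitehead
    (hW : Literature.AlgebraicTopology.Homotopy.Manifold.contractibleSpace_of_simplyConnected_of_acyclic.{0}) {n : ℕ} (hn : 3 ≤ n)
    (S : HomotopySphere n) (p : S.carrier) : ContractibleSpace ↥(({p}ᶜ : Set S.carrier)) :=
  haveI : SimplyConnectedSpace ↥(({p}ᶜ : Set S.carrier)) :=
    S.simplyConnectedSpace_compl_singleton hn p
  hW.of_isOpen n isOpen_compl_singleton fun k hk =>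
    S.isZero_singularHomology_compl_singleton (by omega) p hk

/-- **`contractibleSpace_compl_image_ball` in dimensions `n ≥ 3` from Whitehead–Hurewicz**:
`Σ ∖ i(B)` is a deformation retract (`BallComplement.homotopyEquiv`) of the contractible
`Σ ∖ {i 0}` (`contractibleSpace_compl_singleton_of_whitehead`). (Kosinski 1993, VI §1–§2.)
[cite: Kosinski1993, Ch. VI §2 Prop. 2.1] [cite: Bredon1993, Ch. VII Cor. 10.11] -/
theorem contractibleSpace_compl_image_ball_of_whitehead
    (hW : Literature.AlgebraicTopology.Homotopy.Manifold.contractibleSpace_of_simplyConnected_of_acyclic.{0}) {n : ℕ} (hn : 3 ≤ n)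
    (S : HomotopySphere n) {i : 𝔼 n → S.carrier}
    (hi : Manifold.IsSmoothEmbedding 𝓘(ℝ, 𝔼 n) (𝓡 n) ∞ i) :
    ContractibleSpace ↥((i '' ball (0 : 𝔼 n) 1)ᶜ) :=
  haveI := contractibleSpace_compl_singleton_of_whitehead hW hn S (i 0)
  (Literature.AlgebraicTopology.Homotopy.BallComplement.homotopyEquiv (isOpenEmbedding_of_isSmoothEmbedding_euclidean hi)).contractibleSpace

/-! ### Assembly: the punctured form (`HomotopySpheresInverse.lean`) -/

/-- **Punctured homotopy spheres are contractible (`n ≥ 2`), from Whitehead–Hurewicz and the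
smooth Poincaré conjecture in dimension `2`.** The named fact
`HomotopySphere.contractibleSpace_compl_singleton` of `HomotopySpheresInverse.lean` (the homotopy
theory in Kervaire–Milnor 1963, proof of Lemma 2.4, p. 507) follows from (a) the Whitehead–Hurewicz
recognition principle for manifolds (`Literature.AlgebraicTopology.Homotopy.Manifold.contractibleSpace_of_simplyConnected_of_acyclic`),
used for `n ≥ 3`, and (b) the smooth Poincaré conjecture in dimension `2` (classification of
surfaces), used for `n = 2` together with the stereographic projection; the rest is proved.
[cite: KervaireMilnorAnnals1963, Lemma 2.4, proof (p. 507)] -/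
theorem contractibleSpace_compl_singleton_of
    (hW : Literature.AlgebraicTopology.Homotopy.Manifold.contractibleSpace_of_simplyConnected_of_acyclic.{0})
    (h2 : ∀ (M : Type) [TopologicalSpace M] [T2Space M] [SecondCountableTopology M],
      ContinuousMap.HomotopyEquiv.NonemptyDiffeomorphSphere M 2) :
    HomotopySphere.contractibleSpace_compl_singleton := by
  intro n S p hn
  change ContractibleSpace ↥(({p}ᶜ : Set S.carrier))
  rcases (show n = 2 ∨ 3 ≤ n by omega) with rfl | h3
  · exact contractibleSpace_compl_singleton_of_nonemptyDiffeomorphSphere h2 S p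
  · exact contractibleSpace_compl_singleton_of_whitehead hW h3 S p

/-- The same, with the dimension-`2` input taken from the tree fact
`Literature.Topology.FourManifolds.nonemptyDiffeomorphSphere_of_mem` (spc4.S32). [cite: KervaireMilnorAnnals1963, Lemma 2.4, proof (p. 507)] -/
theorem contractibleSpace_compl_singleton_of_facts
    (hW : Literature.AlgebraicTopology.Homotopy.Manifold.contractibleSpace_of_simplyConnected_of_acyclic.{0})
    (h32 : FourManifolds.nonemptyDiffeomorphSphere_of_mem.{0}) :
    HomotopySphere.contractibleSpace_compl_singleton :=
  contractibleSpace_compl_singleton_of hW fun M _ _ _ => h32 2 (by simp) M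

/-! ### Assembly -/

/-- **Punctured homotopy spheres are contractible, from Whitehead–Hurewicz and the smooth
Poincaré conjecture in dimensions `1, 2`.** The named fact
`HomotopySphere.contractibleSpace_compl_image_ball` (Kosinski 1993, VI §1) follows from
(a) the Whitehead–Hurewicz recognition principle for manifolds
(`Literature.AlgebraicTopology.Homotopy.Manifold.contractibleSpace_of_simplyConnected_of_acyclic`; Bredon 1993, VII Cor. 10.11,
Milnor 1959, Cor. 1), used for `n ≥ 3`, and (b) the smooth Poincaré conjecture in dimensions `1`
and `2` (classification of curves and surfaces), used for `n = 1, 2`; dimension `0` and all the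
rest is proved. [cite: Kosinski1993, Ch. VI §1 (remark before Cor. 1.4)] -/
theorem contractibleSpace_compl_image_ball_of
    (hW : Literature.AlgebraicTopology.Homotopy.Manifold.contractibleSpace_of_simplyConnected_of_acyclic.{0})
    (h12 : ∀ n : ℕ, n = 1 ∨ n = 2 → ∀ (M : Type) [TopologicalSpace M] [T2Space M]
      [SecondCountableTopology M], ContinuousMap.HomotopyEquiv.NonemptyDiffeomorphSphere M n) :
    contractibleSpace_compl_image_ball := by
  intro n S i hi
  rcases Nat.lt_or_ge n 3 with hn | hn
  · interval_cases n
    · exact S.contractibleSpace_compl_image_ball_zero i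
    · exact contractibleSpace_compl_image_ball_of_nonemptyDiffeomorphSphere
        (h12 1 (Or.inl rfl)) S hi
    · exact contractibleSpace_compl_image_ball_of_nonemptyDiffeomorphSphere
        (h12 2 (Or.inr rfl)) S hi
  · exact contractibleSpace_compl_image_ball_of_whitehead hW hn S hi

/-- The same, with the low-dimensional input taken from the tree fact
`Literature.Topology.FourManifolds.nonemptyDiffeomorphSphere_of_mem` (spc4.S32: the smooth Poincaré conjecture holds in
dimensions `1, 2, 3, 5, 6, 12, 56, 61`; Kervaire–Milnor 1963, Wang–Xu 2017). [cite: Kosinski1993, Ch. VI §1 (remark before Cor. 1.4)] -/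
theorem contractibleSpace_compl_image_ball_of_facts
    (hW : Literature.AlgebraicTopology.Homotopy.Manifold.contractibleSpace_of_simplyConnected_of_acyclic.{0})
    (h32 : FourManifolds.nonemptyDiffeomorphSphere_of_mem.{0}) : contractibleSpace_compl_image_ball :=
  contractibleSpace_compl_image_ball_of hW fun n hn M _ _ _ =>
    h32 n (by rcases hn with rfl | rfl <;> simp) M

/-- **The sum of two homotopy spheres is a homotopy sphere, from Whitehead–Hurewicz and the
low-dimensional smooth Poincaré conjecture.** Kervaire–Milnor's statement (*Groups of homotopy
spheres I* (1963), §2, p. 505: "It is clear that the sum of two homotopy `n`-spheres is a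
homotopy `n`-sphere"; tree fact `HomotopySphere.nonempty_homotopyEquiv_sphere_of_isConnectedSum`,
all `n`) follows from the two named facts
`Literature.AlgebraicTopology.Homotopy.Manifold.contractibleSpace_of_simplyConnected_of_acyclic` (Bredon 1993, VII Cor. 10.11 +
Milnor 1959, Cor. 1) and `Literature.Topology.FourManifolds.nonemptyDiffeomorphSphere_of_mem` (spc4.S32, dimensions
`1, 2` used); the suspension argument (`SuspensionLikeCover.lean`), the Mayer–Vietoris and
general-position computations for punctured homotopy spheres, Palais' disc theorem and
dimension `0` are proved. [cite: KervaireMilnorAnnals1963, §2 (p. 505)] [cite: Kosinski1993, Ch. VI §2 Prop. 2.1] -/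
theorem nonempty_homotopyEquiv_sphere_of_isConnectedSum_of_facts
    (hW : Literature.AlgebraicTopology.Homotopy.Manifold.contractibleSpace_of_simplyConnected_of_acyclic.{0})
    (h32 : FourManifolds.nonemptyDiffeomorphSphere_of_mem.{0}) :
    nonempty_homotopyEquiv_sphere_of_isConnectedSum :=
  nonempty_homotopyEquiv_sphere_of_isConnectedSum_of (contractibleSpace_compl_image_ball_of_facts hW h32)

end HomotopySphere

end Literature.Topology.FourManifolds

end
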